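import Summits.HodgeConjecture.HodgeConjecture.Theorems.CyclicUnitaryPowersNodalPencilPackage
import Literature.AlgebraicGeometry.HodgeTheory.CyclicCoverPencilTransport
import Literature.AlgebraicGeometry.HodgeTheory.LocalMonodromyDatumConjugate
import HarnessLib

/-!
# K1-A helper: the rational transport along a small circle of the nodal pencil carries the local-monodromy datum
# (route `CyclicUnitaryPowers`, item stmt-HodgeConjecture-19544; programme "localisation", A5 assembly)

Prover seat `hodge-nonav-prover-Ax` (g10), cell `hodge-nonav`. Helper file `--supports stmt-HodgeConjecture-19544`; sorry-free; no
definition, no named fact; nothing here says HC ∕ HC_AV is proved.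

Combination of the geometric monodromy package (`exists_nodalPencil_monodromy_package`: the monodromy map `h`, its inverse `k`,
and the local-monodromy datum of `h(1, ·)` on each member `X_c`) with the transport computation
(`exists_isRatTransport_pencilCircle`: along a loop `γ₀` of the Carlson–Toledo base whose branch forms run through the circle
`f₁ + e^{2πiu}ε·x₂^p`, the rational transport of `R²u_*ℚ` is `r^*`, `r` the inverse holonomy `k(1, ·)` read in the fibre
`X_{s₀}(ℂ) ≃ₜ X_ε`). Since `r = Ψ⁻¹ ∘ hY⁻¹ ∘ Ψ` for the identification `Ψ : X_{s₀}(ℂ) ≃ₜ X_ε` and the time-one map `hY`, the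
transport is conjugate to `(hY^*)⁻¹`, and the datum `∃ V, (T−1)H² ⊆ V, Σ_{i<p} Tⁱ|_V = 0, dim V ≤ p − 1` passes to inverses
(`exists_localMonodromyDatum_symm`) and conjugates (`exists_localMonodromyDatum_of_conj`). Main result
`exists_isRatTransport_datum_pencilCircle`: **there is `ε₀ > 0` such that for every `0 < |ε| < ε₀` and every such loop `γ₀` the
rational transport along `cyclicCoverLoopClass p γ₀` exists and carries the datum** — the geometric input `hG` of
`nodalMeridianLocalMonodromyBound_of_circle` up to reading meridian circles as such loops.

## References

* [CarlsonToledo1999] J. A. Carlson, D. Toledo, Duke Math. J. 97 (1999), §6 (kdoublept) (held text p0013–p0014).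
* [VoisinHodgeI2002] C. Voisin, Hodge Theory and Complex Algebraic Geometry I, §9.2.1, Prop. 9.5.
* [ArnoldGuseinzadeVarchenko2012] V. I. Arnold, S. M. Gusein-Zade, A. N. Varchenko, Singularities of Differentiable Maps II, Part I §1.1, §2.1.
-/

set_option linter.dupNamespace false

noncomputable section

open CategoryTheory AlgebraicGeometry MvPolynomial TopologicalSpace Set Topology Filter
open scoped Real unitInterval
open Literature.AlgebraicGeometry.Motives Literature.AlgebraicGeometry.Motives.UniversalHypersurface
open Literature.AlgebraicGeometry.HodgeTheory Literature.AlgebraicGeometry.HodgeTheory.UniversalHypersurface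
open Literature.Geometry.ComplexAnalytic Literature.Geometry.Manifold
open Literature.AlgebraicTopology.SingularHomology
open Summit.HodgeConjecture.HodgeConjecture.Theorems.CyclicUnitaryPowersNodalPencilPackage

namespace Summit.HodgeConjecture.HodgeConjecture.Theorems.CyclicUnitaryPowersNodalPencilCircleDatum

/-! ### §1 The datum passes to the inverse -/

section Inverse

variable {K : Type*} [Field K] {V : Type*} [AddCommGroup V] [Module K V]

/-- `Tⁱ (T⁻ⁱ v) = v`. [cite: CarlsonToledo1999, §6 (kdoublept)] -/
theorem pow_apply_symm_pow_apply (T : V ≃ₗ[K] V) (i : ℕ) (v : V) : (T ^ i) ((T.symm ^ i) v) = v := by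
  induction i generalizing v with
  | zero => simp
  | succ i ih => rw [pow_succ, pow_succ', LinearEquiv.mul_apply, LinearEquiv.mul_apply, T.apply_symm_apply, ih]

/-- **The local-monodromy datum passes to the inverse**: if `T x − x ∈ U` for all `x` and `Σ_{i<p} Tⁱ = 0` on `U`, then the same
holds for `T⁻¹` with the same `U` (`T⁻¹x − x = −(Ty − y)` for `y = T⁻¹x`; `T^{p−1} Σ T^{−i} v = Σ T^{p−1−i} v = 0`).
[cite: CarlsonToledo1999, §6 (kdoublept) (held text p0013–p0014)] -/
theorem exists_localMonodromyDatum_symm {p m : ℕ} (T : V ≃ₗ[K] V)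
    (h : ∃ U : Submodule K V, (∀ x, T x - x ∈ U) ∧ (∀ v ∈ U, (∑ i ∈ Finset.range p, (T ^ i) v) = 0) ∧
      Module.finrank K U ≤ m) :
    ∃ U : Submodule K V, (∀ x, T.symm x - x ∈ U) ∧ (∀ v ∈ U, (∑ i ∈ Finset.range p, (T.symm ^ i) v) = 0) ∧
      Module.finrank K U ≤ m := by
  obtain ⟨U, hU₁, hU₂, hU₃⟩ := h
  refine ⟨U, fun x => ?_, fun v hv => ?_, hU₃⟩
  · have h1 := U.neg_mem (hU₁ (T.symm x))
    rwa [T.apply_symm_apply, neg_sub] at h1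
  · -- apply the injective `T^{p-1}`
    apply (T ^ (p - 1)).injective
    rw [map_sum, map_zero]
    have hterm : ∀ i ∈ Finset.range p, (T ^ (p - 1)) ((T.symm ^ i) v) = (T ^ (p - 1 - i)) v := by
      intro i hi
      have hi' : i < p := Finset.mem_range.mp hi
      have hsplit : T ^ (p - 1) = T ^ (p - 1 - i) * T ^ i := by rw [← pow_add]; congr 1; omega
      rw [hsplit, LinearEquiv.mul_apply, pow_apply_symm_pow_apply]
    rw [Finset.sum_congr rfl hterm, Finset.sum_range_reflect (fun j => (T ^ j) v) p]
    exact hU₂ v hv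

end Inverse

/-! ### §2 The circle datum -/

/-- **The rational transport along a small circle of the nodal pencil exists and carries the local-monodromy datum.** For
`p ≥ 3` there is `ε₀ > 0` such that for every `0 < |ε| < ε₀` and every loop `γ₀` at `s₀` in the base of the Carlson–Toledo family
with `b(γ₀ u) = b(x₃^p − f₁) − e^{2πiu}ε·e_{x₂^p}`: there are a rational transport `T` of `R²u_*ℚ` along `cyclicCoverLoopClass p γ₀`
and a subspace `V ⊆ H²(X_{s₀}(ℂ); ℚ)` with `(T − 1)H² ⊆ V`, `Σ_{i<p} Tⁱ|_V = 0`, `dim V ≤ p − 1`.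
[cite: CarlsonToledo1999, §6 (kdoublept) (held text p0013–p0014)] [cite: VoisinHodgeI2002, §9.2.1 and Prop. 9.5]
[cite: ArnoldGuseinzadeVarchenko2012, Part I §1.1 and §2.1] -/
theorem exists_isRatTransport_datum_pencilCircle {p : ℕ} [NeZero p] (hp : 3 ≤ p) :
    ∃ ε₀ : ℝ, 0 < ε₀ ∧ ∀ (ε : ℂ), ε ≠ 0 → ‖ε‖ < ε₀ →
      ∀ {s₀ : ComplexPoints (cyclicCoverBase p)} (γ₀ : Path s₀ s₀),
        (∀ u : I, coeffVector ℂ 2 p (AlgPoints.map (toBaseSpz ℂ 2 p (cyclicCoverSpz p)) (γ₀ u)) =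
          coeffsOf 2 p (cyclicCoverForm p (X 2 ^ (p - 2) * (X 0 * X 1) + X 0 ^ p + X 1 ^ p)) -
            Pi.single (regPowIndex 2 p 2) (Complex.exp (((2 * π * u : ℝ) : ℂ) * Complex.I) * ε)) →
        ∃ (T : bettiCohomology (fiberOver (cyclicCoverFamily p) s₀) 2 ≃ₗ[ℚ] bettiCohomology (fiberOver (cyclicCoverFamily p) s₀) 2)
          (V : Submodule ℚ (bettiCohomology (fiberOver (cyclicCoverFamily p) s₀) 2)),
          IsRatTransport (cyclicCoverFamily p) 2 (cyclicCoverFamily_locallyTrivial p) (cyclicCoverLoopClass p γ₀) T ∧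
          (∀ x, T x - x ∈ V) ∧ (∀ v ∈ V, (∑ i ∈ Finset.range p, (T ^ i) v) = 0) ∧ Module.finrank ℚ V ≤ p - 1 := by
  obtain ⟨δ₀, h, k, hδ₀, hhc, hh0, hhk, hdat⟩ := exists_nodalPencil_monodromy_package hp
  refine ⟨δ₀, hδ₀, fun ε hε0 hεδ s₀ γ₀ hγ => ?_⟩
  -- the transport along the circle is `r^*`, `r` the inverse holonomy read in the fibre
  obtain ⟨f, r, T, hfr, hrf, hfr', hT, hTr⟩ := exists_isRatTransport_pencilCircle hp h k hhc hh0 hhk hε0 hεδ γ₀ hγ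
  -- the datum of the time-one map on the member `X_ε`
  obtain ⟨hY, hYval, hdatY⟩ := hdat ε hε0 hεδ
  -- notation for the spaces
  have hs₀ := transport_coeff_base γ₀ hγ
  have hset : {Q : ComplexPoints (regularTotal ℂ 2 p) |
      regCoeff ℂ 2 p Q = coeffVector ℂ 2 p (AlgPoints.map (toBaseSpz ℂ 2 p (cyclicCoverSpz p)) s₀)} = pencilFibre p ε := by
    ext Q; rw [mem_setOf_eq, mem_pencilFibre_iff_regCoeff_eq hp, hs₀]
  let Ψ : ComplexPoints (fiberOver (cyclicCoverFamily p) s₀) ≃ₜ ↥(pencilFibre p ε) :=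
    (cycFibreHomeo p s₀).trans (Homeomorph.setCongr hset)
  have hΨval : ∀ y, ((Ψ y : ↥(pencilFibre p ε)) : ComplexPoints (regularTotal ℂ 2 p)) = cycFibreToReg p s₀ y := fun y => rfl
  -- `f = Ψ⁻¹ ∘ hY ∘ Ψ`
  have hfΨ : ∀ y, Ψ (f y) = hY (Ψ y) := by
    intro y
    obtain ⟨hy, hfy, -⟩ := hfr y
    apply Subtype.ext
    rw [hΨval, hfy, hYval]
    rfl
  -- the homeomorphism `f` (inverse `r`) and the induced homeomorphism of `X_ε`
  let ηY : ComplexPoints (fiberOver (cyclicCoverFamily p) s₀) ≃ₜ ComplexPoints (fiberOver (cyclicCoverFamily p) s₀) :=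
    { toFun := f, invFun := r, left_inv := hrf, right_inv := hfr', continuous_toFun := f.continuous,
      continuous_invFun := r.continuous }
  let ηX : ↥(pencilFibre p ε) ≃ₜ ↥(pencilFibre p ε) := Ψ.symm.trans (ηY.trans Ψ)
  have hηX : (ηX : C(↥(pencilFibre p ε), ↥(pencilFibre p ε))) = hY := by
    refine ContinuousMap.ext fun x => ?_
    change Ψ (f (Ψ.symm x)) = hY x
    rw [hfΨ, Ψ.apply_symm_apply]
  -- the datum of `τX = hY^*` and of its inverse
  let τX : singularCohomology ℚ ℚ ↥(pencilFibre p ε) 2 ≃ₗ[ℚ] singularCohomology ℚ ℚ ↥(pencilFibre p ε) 2 :=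
    (singularCohomology.mapIso ℚ ℚ ηX 2).toLinearEquiv
  have hτX : ∀ x, τX x = (singularCohomology.map ℚ ℚ hY 2).hom x := fun x => by
    change (singularCohomology.mapIso ℚ ℚ ηX 2).hom x = _
    rw [singularCohomology.mapIso_hom, hηX]
  have hdatX := hdatY τX hτX
  have hdatX' := exists_localMonodromyDatum_symm τX hdatX
  -- conjugation by `A = (Ψ⁻¹)^* : H²(X_{s₀}(ℂ)) ≃ H²(X_ε)`
  haveI : Module.Finite ℚ (bettiCohomology (fiberOver (cyclicCoverFamily p) s₀) 2) :=
    BettiUniverse.finite ((isSmoothProjectiveFamily_cyclicCoverFamily p).isSmoothProjective s₀) 2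
  let A : bettiCohomology (fiberOver (cyclicCoverFamily p) s₀) 2 ≃ₗ[ℚ] singularCohomology ℚ ℚ ↥(pencilFibre p ε) 2 :=
    (singularCohomology.mapIso ℚ ℚ Ψ.symm 2).toLinearEquiv
  haveI : FiniteDimensional ℚ (singularCohomology ℚ ℚ ↥(pencilFibre p ε) 2) := Module.Finite.equiv A
  obtain ⟨U, hU₁, hU₂, hU₃⟩ := exists_localMonodromyDatum_of_conj (p := p) (m := p - 1) τX.symm A hdatX'
  -- `r = Ψ⁻¹ ∘ ηX⁻¹ ∘ Ψ`
  have hr : r = (Ψ.symm : C(↥(pencilFibre p ε), ComplexPoints (fiberOver (cyclicCoverFamily p) s₀))).comp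
      ((ηX.symm : C(↥(pencilFibre p ε), ↥(pencilFibre p ε))).comp (Ψ.symm.symm : C(ComplexPoints (fiberOver (cyclicCoverFamily p) s₀), ↥(pencilFibre p ε)))) := by
    refine ContinuousMap.ext fun y => ?_
    change r y = Ψ.symm (Ψ (ηY.symm (Ψ.symm (Ψ.symm.symm y))))
    change r y = Ψ.symm (Ψ (r (Ψ.symm (Ψ y))))
    rw [Ψ.symm_apply_apply, Ψ.symm_apply_apply]
  -- `T = A⁻¹ τX⁻¹ A` pointwise
  have hTconj : ∀ v, T v = (A.trans (τX.symm.trans A.symm)) v := by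
    intro v
    rw [hTr v, LinearEquiv.trans_apply, LinearEquiv.trans_apply]
    change _ = (singularCohomology.mapIso ℚ ℚ Ψ.symm 2).inv
      ((singularCohomology.mapIso ℚ ℚ ηX 2).toLinearEquiv.symm ((singularCohomology.mapIso ℚ ℚ Ψ.symm 2).hom v))
    rw [Iso.toLinearEquiv_symm, Iso.toLinearEquiv_apply, Iso.symm_hom, singularCohomology.mapIso_inv,
      singularCohomology.mapIso_inv, singularCohomology.mapIso_hom, ← ModuleCat.comp_apply, ← ModuleCat.comp_apply,
      ← singularCohomology.map_comp, ← singularCohomology.map_comp]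
    exact congrArg (fun g : C(ComplexPoints (fiberOver (cyclicCoverFamily p) s₀), ComplexPoints (fiberOver (cyclicCoverFamily p) s₀)) => (singularCohomology.map ℚ ℚ g 2).hom v) hr
  refine ⟨T, U, hT, fun x => ?_, fun v hv => ?_, hU₃⟩
  · rw [hTconj]; exact hU₁ x
  · have hpow : ∀ i, (T ^ i) v = ((A.trans (τX.symm.trans A.symm)) ^ i) v := fun i => by
      have hTeq : T = A.trans (τX.symm.trans A.symm) := LinearEquiv.ext hTconj
      rw [hTeq]
    simp_rw [hpow]
    exact hU₂ v hv

end Summit.HodgeConjecture.HodgeConjecture.Theorems.CyclicUnitaryPowersNodalPencilCircleDatum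

end
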